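import Literature.NumberTheory.QuadraticFields.BinaryQuadraticFormsClassNumberCountChunks
import HarnessLib

/-!
# Class number of `D = −269 497 867` by row chunks, file H7 of 11: rows `(7000, 7192] ↦ 16`, `(7192, 7379] ↦ 20`, `(7379, 7561] ↦ 16`

Topic `NumberTheory/QuadraticFields`, namespace `Literature.NumberTheory.QuadraticFields.Quadratic`; pure VALUES file (theorems only). The landau-siegel
rescue bed's deep negative ladder rung `D_89^− = D_97^− = D_101^− = −269 497 867` (= 317·419·2029; Lehmer–Lehmer–Shanks 1970) has
`h = 1044` (engines A ≡ B of record). Its kernel evaluation by Cohen's Algorithm 5.3.5 (`BinQF.classNumberCount`,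
`BinaryQuadraticFormsClassNumberCount.lean`) needs ≈ 35 min of kernel time, beyond one declaration's budget (≈ 150 s) and one
file's (≈ 600 s), so the row range `1 ≤ a ≤ 9478` is cut into 33 chunks of roughly equal work (`BinQF.redRowsSumFrom`,
`BinaryQuadraticFormsClassNumberCountChunks.lean`), three per file; the assembly `BinQF.classNumber (−269497867) = 1044` by
`BinQF.redRowsSumFrom_add` is in `ImaginaryQuadraticClassNumbersDeepI.lean`.

## References

* [Cohen1993] H. Cohen, *A Course in Computational Algebraic Number Theory*, GTM 138, §5.3.1 Algorithm 5.3.5.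
* [LehmerLehmerShanks1970] D. H. Lehmer, E. Lehmer, D. Shanks, Math. Comp. 24 (1970) 433–451, §1 and Table.
-/

namespace Literature.NumberTheory.QuadraticFields.Quadratic

/-- Row chunk `a ∈ (7000, 7192]` of Cohen's Algorithm 5.3.5 at `N = 269 497 867`: partial count `16` (one kernel evaluation).
[cite: Cohen1993, §5.3.1 Algorithm 5.3.5] -/
theorem redRowsSumFrom_269497867_7000 : BinQF.redRowsSumFrom 269497867 7000 192 = 16 := by
  decide +kernel

/-- Row chunk `a ∈ (7192, 7379]` of Cohen's Algorithm 5.3.5 at `N = 269 497 867`: partial count `20` (one kernel evaluation).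
[cite: Cohen1993, §5.3.1 Algorithm 5.3.5] -/
theorem redRowsSumFrom_269497867_7192 : BinQF.redRowsSumFrom 269497867 7192 187 = 20 := by
  decide +kernel

/-- Row chunk `a ∈ (7379, 7561]` of Cohen's Algorithm 5.3.5 at `N = 269 497 867`: partial count `16` (one kernel evaluation).
[cite: Cohen1993, §5.3.1 Algorithm 5.3.5] -/
theorem redRowsSumFrom_269497867_7379 : BinQF.redRowsSumFrom 269497867 7379 182 = 16 := by
  decide +kernel

end Literature.NumberTheory.QuadraticFields.Quadratic
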